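import Summits.SmoothPoincare4.SmoothPoincare4.Theorems.EntropyRungCompactShrinkerGapLevelSetCertChunk0
import Summits.SmoothPoincare4.SmoothPoincare4.Theorems.EntropyRungCompactShrinkerGapLevelSetCertChunk1
import Summits.SmoothPoincare4.SmoothPoincare4.Theorems.EntropyRungCompactShrinkerGapLevelSetCertChunk2
import Summits.SmoothPoincare4.SmoothPoincare4.Theorems.EntropyRungCompactShrinkerGapLevelSetCertChunk3
import Summits.SmoothPoincare4.SmoothPoincare4.Theorems.EntropyRungCompactShrinkerGapLevelSetCertChunk4
import Summits.SmoothPoincare4.SmoothPoincare4.Theorems.EntropyRungCompactShrinkerGapLevelSetCertChunk5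
import Summits.SmoothPoincare4.SmoothPoincare4.Theorems.EntropyRungCompactShrinkerGapLevelSetCertChunk6
import HarnessLib

/-!
# STUB 19 `stub_levelSetCertificate` of line cgy-variance-pivot (crux stmt-SmoothPoincare4-10870) — assembly over the chunks

The pure real-analysis inequality behind the v12 re-typing of STUB 7 (`R ≤ 7/2 ⇒ variance budget`, with
`Theorems.stub_varianceBudget_of_certificate`, p122222): for `0 ≤ R ≤ f ≤ 7/2`,
  `(38/5)e^{-f} − 2 + (11/10)(R − 2) + (177/10)(f − 2)e^{-f} − (18/5)((f − R) − (f − 2)²)e^{-f}`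
  `+ (12/25)((f − R)(3 − R) − (R − 2)²) + ½R(2 − R)(e^{7/2−f} − 1) ≤ 0`,
by the chunk helpers `helper_levelSetCert_chunk0 … chunk6` (`EntropyRungCompactShrinkerGapLevelSetCertBase/Chunk0…6.lean`: Taylor
envelopes for the exponentials + exact Handelman certificates checked by `linarith`). Provenance and method: the Base file's docstring.
[cite: ChengRibeiroZhou2022, §3.2 (the CRZ member)] -/

noncomputable section

namespace Summit.SmoothPoincare4.SmoothPoincare4.Theorems

set_option linter.dupNamespace false

/-- **STUB 19 `stub_levelSetCertificate` (line cgy-variance-pivot, skeleton v12)** — the level-set certificate: for all real `f, R`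
with `0 ≤ R ≤ f ≤ 7/2`, `Q(f,R) ≤ 0` (numerically `≤ −0.154`; it is the reduced cost, at `β = 2`, of the six-member level-set LP of the
line with multipliers `11/10, 177/10, −18/5, 12/25, 1` and `κ ≤ 38/5`). Proof: locate the chunk `k/2 ≤ f ≤ (k+1)/2`, `k = 0,…,6`, and
apply its helper. [folklore] -/
theorem stub_levelSetCertificate :
    ∀ f R : ℝ, 0 ≤ R → R ≤ f → f ≤ 7 / 2 →
      38 / 5 * Real.exp (-f) - 2 + 11 / 10 * (R - 2) + 177 / 10 * (f - 2) * Real.exp (-f)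
          - 18 / 5 * ((f - R) - (f - 2) ^ 2) * Real.exp (-f)
          + 12 / 25 * ((f - R) * (3 - R) - (R - 2) ^ 2)
          + 1 / 2 * R * (2 - R) * (Real.exp (7 / 2 - f) - 1) ≤ 0 := by
  intro f R hR hRf hf
  have hf0 : 0 ≤ f := le_trans hR hRf
  rcases le_total f (1 / 2) with h1 | h1
  · exact helper_levelSetCert_chunk0 f R hf0 h1 hR hRf
  rcases le_total f 1 with h2 | h2
  · exact helper_levelSetCert_chunk1 f R h1 h2 hR hRf
  rcases le_total f (3 / 2) with h3 | h3
  · exact helper_levelSetCert_chunk2 f R h2 h3 hR hRf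
  rcases le_total f 2 with h4 | h4
  · exact helper_levelSetCert_chunk3 f R h3 h4 hR hRf
  rcases le_total f (5 / 2) with h5 | h5
  · exact helper_levelSetCert_chunk4 f R h4 h5 hR hRf
  rcases le_total f 3 with h6 | h6
  · exact helper_levelSetCert_chunk5 f R h5 h6 hR hRf
  · exact helper_levelSetCert_chunk6 f R h6 hf hR hRf

end Summit.SmoothPoincare4.SmoothPoincare4.Theorems

end
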